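import Mathlib
import Summits.ResolutionOfSingularities.ResolutionOfSingularities.Theorems.HomologicalConductorPersistenceSurfaceLevelFour
import Literature.AlgebraicGeometry.Resolution.Lipman1969RationalSurfaceSingularities
import HarnessLib

/-!
# Rung S-2 `PersistenceSurface` (stmt-ResolutionOfSingularities-19970) — the RATIONAL / NON-RATIONAL partition of the level-four split (w44b CRUX-PLAN v7 §2.2, §3 o6)

[OURS · L1 w44b · planner res-L1-w44b-plan-1 gen 8; typed targets, AI-written, weaker than expert review; NOT a statement of the manuscript
under study.]  SKETCH for ORDER w44b-o6 (a free reserve files it as `Theorems/HomologicalConductorPersistenceSurfaceRational.lean`, kind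
definition, `--supports stmt-…-19970 --as helper`).  The census of CHAIN v7 §V7.2 partitions surface towers by the class of stage 0,
`T₀ = loc A`: (R) rational or regular — where programme M-rat₄ applies (all later stages rational by Lipman (1.2), tree named fact
`Lipman1969_1_2`) — versus its complement (E) non-rational normal / (N) non-normal (specimen-driven, Σ6/Σ8).  This file types the four
restricted conjectures and the tautological glue back to `SaturationFourSurface` / `LevelFourPersistenceSurface` / `PersistenceSurface`.
Rationality predicate = W4.4's `Literature.AlgebraicGeometry.Resolution.HasRationalSingularity` (Lipman Def. (1.1)); nothing of it is
re-typed here.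
-/

set_option linter.dupNamespace false

namespace Summit.ResolutionOfSingularities.ResolutionOfSingularities.Theorems.HomologicalConductor.PersistenceSurfaceRational

open Summit.ResolutionOfSingularities.ResolutionOfSingularities.Theorems.HomologicalConductor.PersistenceSurfaceLevelFour

/-- [OURS · w44b v7 · o6] LEVEL-FOUR PERSISTENCE on the RATIONAL class (R): the binders of `PersistenceSurface`, plus «stage 0 `T₀ = loc A` has a rational singularity (Lipman (1.1), W4.4's `HasRationalSingularity`) or is regular» ⇒ `ca⁴(T_m) ⊆ ca⁴(T_(m+1))` for every `m`. This is the typed TARGET of programme M-rat₄ (CRUX-PLAN v7 §2.3: every later stage is then rational by Lipman (1.2); one step = CA3 + (E-sur) + (IW-p) ⇒ `hcover` ⇒ HC-1/FC-4), modulo the premises P3/P4/P6 listed there. NOT a statement of the manuscript. -/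
@[conjecture]
def LevelFourPersistenceRational : Prop :=
  ∀ p : ℕ, p.Prime → ∀ (k K : Type) [Field k] [CharP k p] [Field K] [Algebra k K] (O : ValuationSubring K) (A : Subalgebra k K), (∀ c : k, algebraMap k K c ∈ O) → A.FG → IsFractionRing ↥A K → A.toSubring ≤ O.toSubring → ringKrullDim ↥A ≤ 2 → let caAt : ℕ → Subalgebra k K → Set K := fun n A => {x : K | ∃ hx : x ∈ A, ∀ i : ℕ, n ≤ i → ∀ (M N : ModuleCat.{0} ↥A), Module.Finite ↥A M → Module.Finite ↥A N → ∀ e : CategoryTheory.Abelian.Ext.{0} M N i, (⟨x, hx⟩ : ↥A) • e = 0}; let ca : Subalgebra k K → Set K := fun A => {x : K | ∃ hx : x ∈ A, ∃ n : ℕ, ∀ i : ℕ, n ≤ i → ∀ (M N : ModuleCat.{0} ↥A), Module.Finite ↥A M → Module.Finite ↥A N → ∀ e : CategoryTheory.Abelian.Ext.{0} M N i, (⟨x, hx⟩ : ↥A) • e = 0}; let loc : Subalgebra k K → Subalgebra k K := fun A => Algebra.adjoin k {y : K | ∃ a ∈ A, ∃ s ∈ A, s⁻¹ ∈ O ∧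 y = a * s⁻¹}; let chart : Subalgebra k K → Subalgebra k K := fun A => Algebra.adjoin k ((A : Set K) ∪ {y : K | ∃ c ∈ ca A, ∃ x ∈ ca A, x ≠ 0 ∧ (∀ c' ∈ ca A, c' * x⁻¹ ∈ O) ∧ y = c * x⁻¹}); let nrm : Subalgebra k K → Subalgebra k K := fun B => Algebra.adjoin k {y : K | IsIntegral ↥B y}; let tower : Subalgebra k K → ℕ → Subalgebra k K := fun A m => @Nat.rec (fun _ => Subalgebra k K) (loc A) (fun _ B => loc (nrm (chart B))) m; (Literature.AlgebraicGeometry.Resolution.HasRationalSingularity ↥(tower A 0) ∨ IsRegularLocalRing ↥(tower A 0)) → ∀ m : ℕ, caAt 4 (tower A m) ⊆ caAt 4 (tower A (m + 1))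

/-- [OURS · w44b v7 · o6] LEVEL-FOUR PERSISTENCE on the complementary class (E) ∪ (N): stage 0 neither rational nor regular (non-rational normal = Σ6, non-normal = Σ8). No theory line; specimen-driven (E₁₂: step 0→1 KEPT certified, stub-4 SIGMA6-E12). A failure here would NOT refute `PersistenceSurface` (level 4 is the rational-stage shape). NOT a statement of the manuscript. -/
@[conjecture]
def LevelFourPersistenceNonrational : Prop :=
  ∀ p : ℕ, p.Prime → ∀ (k K : Type) [Field k] [CharP k p] [Field K] [Algebra k K] (O : ValuationSubring K) (A : Subalgebra k K), (∀ c : k, algebraMap k K c ∈ O) → A.FG → IsFractionRing ↥A K → A.toSubring ≤ O.toSubring → ringKrullDim ↥A ≤ 2 → let caAt : ℕ → Subalgebra k K → Set K := fun n A => {x : K | ∃ hx : x ∈ A, ∀ i : ℕ, n ≤ i → ∀ (M N : ModuleCat.{0} ↥A), Module.Finite ↥A M → Module.Finite ↥A N → ∀ e : CategoryTheory.Abelian.Ext.{0} M N i, (⟨x, hx⟩ : ↥A) • e = 0}; let ca : Subalgebra k K → Set K := fun A => {x : K | ∃ hx : x ∈ A, ∃ n : ℕ, ∀ i : ℕ,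 n ≤ i → ∀ (M N : ModuleCat.{0} ↥A), Module.Finite ↥A M → Module.Finite ↥A N → ∀ e : CategoryTheory.Abelian.Ext.{0} M N i, (⟨x, hx⟩ : ↥A) • e = 0}; let loc : Subalgebra k K → Subalgebra k K := fun A => Algebra.adjoin k {y : K | ∃ a ∈ A, ∃ s ∈ A, s⁻¹ ∈ O ∧ y = a * s⁻¹}; let chart : Subalgebra k K → Subalgebra k K := fun A => Algebra.adjoin k ((A : Set K) ∪ {y : K | ∃ c ∈ ca A, ∃ x ∈ ca A, x ≠ 0 ∧ (∀ c' ∈ ca A, c' * x⁻¹ ∈ O) ∧ y = c * x⁻¹}); let nrm : Subalgebra k K → Subalgebra k K := fun B => Algebra.adjoin k {y : K | IsIntegral ↥B y}; let tower : Subalgebra k K → ℕ → Subalgebra k K := fun A m => @Nat.rec (fun _ => Subalgebra k K) (loc A) (fun _ B => loc (nrm (chart B))) m; ¬ (Literature.AlgebraicGeometry.Resolution.HasRationalSingularity ↥(tower A 0) ∨ IsRegularLocalRing ↥(tower A 0)) → ∀ m : ℕ, caAt 4 (tower A m) ⊆ caAt 4 (tower A (m + 1))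

/-- [OURS · w44b v7 · o6] SATURATION AT LEVEL FOUR on the rational class (R): `ca(T_m) ⊆ ca⁴(T_m)` at every stage of a tower whose stage 0 is rational or regular — implied at quotient stages by (Rec) (RDP: periodicity; cyclic: idea-1 REC-CYCLIC; dihedral |G| ≤ 80: tri-2 SIGMA9), OPEN at non-quotient rational stages (Σ9). NOT a statement of the manuscript. -/
@[conjecture]
def SaturationFourRational : Prop :=
  ∀ p : ℕ, p.Prime → ∀ (k K : Type) [Field k] [CharP k p] [Field K] [Algebra k K] (O : ValuationSubring K) (A : Subalgebra k K), (∀ c : k, algebraMap k K c ∈ O) → A.FG → IsFractionRing ↥A K → A.toSubring ≤ O.toSubring → ringKrullDim ↥A ≤ 2 → let caAt : ℕ → Subalgebra k K → Set K := fun n A => {x : K | ∃ hx : x ∈ A, ∀ i : ℕ, n ≤ i → ∀ (M N : ModuleCat.{0} ↥A), Module.Finite ↥A M → Module.Finite ↥A N → ∀ e : CategoryTheory.Abelian.Ext.{0} M N i, (⟨x, hx⟩ : ↥A) • e = 0}; let ca : Subalgebra k K → Set K := fun A => {x : K | ∃ hx : x ∈ A, ∃ n : ℕ, ∀ i : ℕ,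 n ≤ i → ∀ (M N : ModuleCat.{0} ↥A), Module.Finite ↥A M → Module.Finite ↥A N → ∀ e : CategoryTheory.Abelian.Ext.{0} M N i, (⟨x, hx⟩ : ↥A) • e = 0}; let loc : Subalgebra k K → Subalgebra k K := fun A => Algebra.adjoin k {y : K | ∃ a ∈ A, ∃ s ∈ A, s⁻¹ ∈ O ∧ y = a * s⁻¹}; let chart : Subalgebra k K → Subalgebra k K := fun A => Algebra.adjoin k ((A : Set K) ∪ {y : K | ∃ c ∈ ca A, ∃ x ∈ ca A, x ≠ 0 ∧ (∀ c' ∈ ca A, c' * x⁻¹ ∈ O) ∧ y = c * x⁻¹}); let nrm : Subalgebra k K → Subalgebra k K := fun B => Algebra.adjoin k {y : K | IsIntegral ↥B y}; let tower : Subalgebra k K → ℕ → Subalgebra k K := fun A m => @Nat.rec (fun _ => Subalgebra k K) (loc A) (fun _ B => loc (nrm (chart B))) m; (Literature.AlgebraicGeometry.Resolution.HasRationalSingularity ↥(tower A 0) ∨ IsRegularLocalRing ↥(tower A 0)) → ∀ m : ℕ, ca (tower A m) ⊆ caAt 4 (tower A m)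

/-- [OURS · w44b v7 · o6] SATURATION AT LEVEL FOUR on the complementary class (E) ∪ (N) (Σ6/Σ8); unknown even at E₁₂ (stub-4 to read off from the Loewy data). NOT a statement of the manuscript. -/
@[conjecture]
def SaturationFourNonrational : Prop :=
  ∀ p : ℕ, p.Prime → ∀ (k K : Type) [Field k] [CharP k p] [Field K] [Algebra k K] (O : ValuationSubring K) (A : Subalgebra k K), (∀ c : k, algebraMap k K c ∈ O) → A.FG → IsFractionRing ↥A K → A.toSubring ≤ O.toSubring → ringKrullDim ↥A ≤ 2 → let caAt : ℕ → Subalgebra k K → Set K := fun n A => {x : K | ∃ hx : x ∈ A, ∀ i : ℕ, n ≤ i → ∀ (M N : ModuleCat.{0} ↥A), Module.Finite ↥A M → Module.Finite ↥A N → ∀ e : CategoryTheory.Abelian.Ext.{0} M N i, (⟨x, hx⟩ : ↥A) • e = 0}; let ca : Subalgebra k K → Set K := fun A => {x : K | ∃ hx : x ∈ A, ∃ n : ℕ, ∀ i : ℕ, n ≤ i → ∀ (M N : ModuleCat.{0} ↥A), Module.Finite ↥A M → Module.Finite ↥A N → ∀ e : CategoryTheory.Abelian.Ext.{0} M N i,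 (⟨x, hx⟩ : ↥A) • e = 0}; let loc : Subalgebra k K → Subalgebra k K := fun A => Algebra.adjoin k {y : K | ∃ a ∈ A, ∃ s ∈ A, s⁻¹ ∈ O ∧ y = a * s⁻¹}; let chart : Subalgebra k K → Subalgebra k K := fun A => Algebra.adjoin k ((A : Set K) ∪ {y : K | ∃ c ∈ ca A, ∃ x ∈ ca A, x ≠ 0 ∧ (∀ c' ∈ ca A, c' * x⁻¹ ∈ O) ∧ y = c * x⁻¹}); let nrm : Subalgebra k K → Subalgebra k K := fun B => Algebra.adjoin k {y : K | IsIntegral ↥B y}; let tower : Subalgebra k K → ℕ → Subalgebra k K := fun A m => @Nat.rec (fun _ => Subalgebra k K) (loc A) (fun _ B => loc (nrm (chart B))) m; ¬ (Literature.AlgebraicGeometry.Resolution.HasRationalSingularity ↥(tower A 0) ∨ IsRegularLocalRing ↥(tower A 0)) → ∀ m : ℕ, ca (tower A m) ⊆ caAt 4 (tower A m)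

/-- GLUE: the two classes exhaust all towers (excluded middle on the stage-0 predicate). -/
theorem levelFourPersistenceSurface_of_rational_of_nonrational
    (hR : LevelFourPersistenceRational) (hN : LevelFourPersistenceNonrational) : LevelFourPersistenceSurface := by
  intro p hp k K _ _ _ _ O A hk hA hfr hAO hdim caAt ca loc chart nrm tower m x hx
  rcases Classical.em (Literature.AlgebraicGeometry.Resolution.HasRationalSingularity ↥(tower A 0) ∨
      IsRegularLocalRing ↥(tower A 0)) with h | h
  · exact hR p hp k K O A hk hA hfr hAO hdim h m hx
  · exact hN p hp k K O A hk hA hfr hAO hdim h m hx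

/-- GLUE for saturation. -/
theorem saturationFourSurface_of_rational_of_nonrational
    (hR : SaturationFourRational) (hN : SaturationFourNonrational) : SaturationFourSurface := by
  intro p hp k K _ _ _ _ O A hk hA hfr hAO hdim caAt ca loc chart nrm tower m x hx
  rcases Classical.em (Literature.AlgebraicGeometry.Resolution.HasRationalSingularity ↥(tower A 0) ∨
      IsRegularLocalRing ↥(tower A 0)) with h | h
  · exact hR p hp k K O A hk hA hfr hAO hdim h m hx
  · exact hN p hp k K O A hk hA hfr hAO hdim h m hx

/-- Projections (the surface statements restrict to each class). -/
theorem levelFourPersistenceRational_of_surface (h : LevelFourPersistenceSurface) : LevelFourPersistenceRational := by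
  intro p hp k K _ _ _ _ O A hk hA hfr hAO hdim caAt ca loc chart nrm tower _ m x hx
  exact h p hp k K O A hk hA hfr hAO hdim m hx

/-- Projection of `LevelFourPersistenceSurface` to the complementary class (E) ∪ (N). -/
theorem levelFourPersistenceNonrational_of_surface (h : LevelFourPersistenceSurface) : LevelFourPersistenceNonrational := by
  intro p hp k K _ _ _ _ O A hk hA hfr hAO hdim caAt ca loc chart nrm tower _ m x hx
  exact h p hp k K O A hk hA hfr hAO hdim m hx

/-- Projection of `SaturationFourSurface` to the rational / regular class (R). -/
theorem saturationFourRational_of_surface (h : SaturationFourSurface) : SaturationFourRational := by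
  intro p hp k K _ _ _ _ O A hk hA hfr hAO hdim caAt ca loc chart nrm tower _ m x hx
  exact h p hp k K O A hk hA hfr hAO hdim m hx

/-- Projection of `SaturationFourSurface` to the complementary class (E) ∪ (N). -/
theorem saturationFourNonrational_of_surface (h : SaturationFourSurface) : SaturationFourNonrational := by
  intro p hp k K _ _ _ _ O A hk hA hfr hAO hdim caAt ca loc chart nrm tower _ m x hx
  exact h p hp k K O A hk hA hfr hAO hdim m hx

/-- THE FOUR-PIECE GLUE: the rung `PersistenceSurface` from saturation and level-four persistence on each class. -/
theorem persistenceSurface_of_pieces (hSR : SaturationFourRational) (hSN : SaturationFourNonrational)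
    (hLR : LevelFourPersistenceRational) (hLN : LevelFourPersistenceNonrational) :
    Summit.ResolutionOfSingularities.ResolutionOfSingularities.Theses.HomologicalConductor.PersistenceSurface :=
  persistenceSurface_of_saturationFour_of_levelFour
    (saturationFourSurface_of_rational_of_nonrational hSR hSN)
    (levelFourPersistenceSurface_of_rational_of_nonrational hLR hLN)

end Summit.ResolutionOfSingularities.ResolutionOfSingularities.Theorems.HomologicalConductor.PersistenceSurfaceRational
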